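import Summits.Ventures.HSemireg.WedgeHankelSubstitutionJordanBlocks

/-!
# Venture HSemireg — THE FULL JORDAN TYPE OF THE SHEAR ON TH-7's CLASSES IN CHARACTERISTIC `p` IS `(p, …, p, n % p + 1)`:
# `dim ker (SbC(shear λ) − 1)^k = ⌊n/p⌋ · min(k, p) + min(k, n % p + 1)` for EVERY `k` (`λ ≠ 0`), from the leading term `(i+1)(i+2)⋯(i+k)·λ^k·E_{i+k}` of
# `(SbC(shear λ) − 1)^k E_i`, the non-increasing drops of the rank sequence of an endomorphism, and the two counts already in the tree (J3: `N^p = 0`; J4: `⌊n/p⌋ + 1` blocks)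

HONEST FRAMING. Part of the Lean index of the computation cell `pub-hsemireg` (seat p10 gen 21, Sunday typer «UNIFORM-IN-n»).
Finite-dimensional EXTERIOR ALGEBRA + linear algebra ONLY: no variety, no cohomology theory, no sheaf, no Ext group, no semiregularity map;
nothing here says that HC / HC_CM / HC_AV holds; no Literature fact is declared or used.  Custodian versions as in `WedgeHankelSiegelIdeal` (1/3) and `WedgeHankelFrameChange`;
the dictionary (the shear = translation of the node on binary forms of degree `n`; in characteristic `p` the translation-stable filtration is by `℘^j·K[ν]_{<m}`,
`℘ = ν^p − λ^{p−1}ν`, giving `⌊n/p⌋` Jordan blocks of size `p` and one of size `n % p + 1`) is QUOTED, never asserted.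

WHAT IS IN THE TREE.  I18 (`WedgeHankelSubstitutionJordan`): one Jordan block when `n!·λ^n ≠ 0`; J3 (`WedgeHankelSubstitutionJordanCharP`): `(SbC(shear λ) − 1)^p = 0` in
characteristic `p`, largest block `min(p, n+1)`; J4 (`WedgeHankelSubstitutionJordanBlocks`): `dim ker (SbC(shear λ) − 1) = n / p + 1`, the coordinate formula
`repr_SbC_shear_sub_one` and the pivot `repr_SbC_shear_sub_one_succ`; I11 `spikeBasis`.  J4's docstring records that block count + largest block do NOT pin the partition
(`p = 5`, `n = 12`: `(5,5,3)` or `(5,4,4)`).  THIS FILE (namespace `Summit.Ventures.HSemireg.Wedge.HankelFrameChange` continued; imports J4 only) pins it: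
* §268 GENERALITIES for an endomorphism `N` of a finite-dimensional space: **`finrank_range_pow_eq_succ_add`** (`rank N^k = rank N^{k+1} + dim(range N^k ⊓ ker N)`),
  **`finrank_range_pow_succ_inf_ker_le`** (these drops are NON-INCREASING in `k`), `finrank_range_pow_add_sum`, **`finrank_ker_pow_eq_sum`** (`dim ker N^k = Σ_{j<k} drops`),
  the arithmetic lemma `sum_range_eq_of_antitone_of_bounds`, and **`finrank_ker_pow_eq_of_nilpotent`: `N^p = 0`, `dim V = pq + s`, `dim ker N = q + 1`, `rank N^{p−1} ≥ q`
  `⇒ dim ker N^k = kq + min(k, s)` for `k ≤ p`** (Jordan type `(p^q, s)` from three numbers).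
* §269 THE LEADING TERM: `repr_SbC_shear_sub_one_eq_zero_of_le` (strict lower triangularity), **`repr_SbC_shear_sub_one_pow_spikeBasis`** (the spike coordinates of
  `(SbC(shear λ) − 1)^k E_i` vanish below `i + k` and equal `(i+1)(i+2)⋯(i+k)·λ^k = (i+1).ascFactorial k · λ^k` AT `i + k`), `SbC_shear_sub_one_pow_spikeBasis_eq_zero`
  (`i + k > n ⇒ = 0`), the triangular-independence lemma `linearIndependent_of_repr_pivot`, **`linearIndependent_SbC_shear_sub_one_pow_spikeBasis`** and
  **`card_le_finrank_range_SbC_shear_sub_one_pow`** (`rank (SbC(shear λ) − 1)^k ≥ #{i : i + k ≤ n, (i+1)⋯(i+k) ≠ 0 in K}`, every field, `λ ≠ 0`).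
* §270 CHARACTERISTIC `p` (`[Fact p.Prime] [CharP K p]`, `λ ≠ 0`): `ascFactorial_mul_prime_succ_cast_ne_zero` (`(mp+1)(mp+2)⋯(mp+j) ≠ 0` for `j < p`),
  **`div_le_finrank_range_SbC_shear_sub_one_pow_pred_char`** (`rank N^{p−1} ≥ (n+1)/p`), and the partition
  **`finrank_ker_SbC_shear_sub_one_pow_char`: `dim ker (SbC(shear λ) − 1)^k = (n / p)·min(k, p) + min(k, n % p + 1)` for every `k`** — Jordan type
  `(p, …, p, n % p + 1)` with `⌊n/p⌋` blocks of size `p`; corollaries **`finrank_range_SbC_shear_sub_one_pow_char`** (the rank), **`finrank_range_pow_inf_ker_SbC_shear_char`**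
  (the number of blocks of size `> k` is `n / p + [k ≤ n % p]`, `k < p`) and **`finrank_range_SbC_shear_sub_one_pow_pred_char`** (`rank N^{p−1} = (n+1)/p` = the number of
  blocks of size exactly `p`).
NOT typed here: the parabolic / unipotent substitutions (same Jordan type, by J11's conjugation — next leaf); the kernel flag `ker N^k = span{E_{n+1−k}, …, E_n}` when `n! ≠ 0`
(next leaf); anything Ext-side.  New names only.
-/

open Module

namespace Summit.Ventures.HSemireg.Wedge.HankelFrameChange

open Summit.Ventures.HSemireg.Wedge Summit.Ventures.HSemireg.Wedge.Kunneth Summit.Ventures.HSemireg.Wedge.Hankel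
  Summit.Ventures.HSemireg.Wedge.BasisFree Summit.Ventures.HSemireg.Wedge.HankelSiegel Summit.Ventures.HSemireg.Wedge.HankelSiegelIdeal
  Summit.Ventures.HSemireg.Wedge.KunnethKernel Summit.Ventures.HSemireg.Wedge.HankelRankOne Summit.Ventures.HSemireg.Wedge.KernelDuality

variable (K : Type*) [Field K] {n : ℕ}

/-! ## §268. Generalities: the drops of the rank sequence of an endomorphism are non-increasing -/

section RankDrops

variable {V : Type*} [AddCommGroup V] [Module K V] [FiniteDimensional K V]

/-- **`rank N^k = rank N^{k+1} + dim (range N^k ⊓ ker N)`** (rank–nullity for `N` restricted to `range N^k`). -/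
theorem finrank_range_pow_eq_succ_add (N : V →ₗ[K] V) (k : ℕ) :
    finrank K ↥(LinearMap.range (N ^ k)) = finrank K ↥(LinearMap.range (N ^ (k + 1))) + finrank K ↥(LinearMap.range (N ^ k) ⊓ LinearMap.ker N) := by
  have h := LinearMap.finrank_range_add_finrank_ker (N.domRestrict (LinearMap.range (N ^ k)))
  rw [LinearMap.range_domRestrict, LinearMap.ker_domRestrict, ← LinearMap.range_comp,
    ← Submodule.finrank_map_subtype_eq (LinearMap.range (N ^ k)) (Submodule.comap (LinearMap.range (N ^ k)).subtype (LinearMap.ker N)),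
    Submodule.map_comap_subtype] at h
  rw [← h, pow_succ', Module.End.mul_eq_comp]

/-- **THE DROPS ARE NON-INCREASING: `dim (range N^{k+1} ⊓ ker N) ≤ dim (range N^k ⊓ ker N)`** (`range N^{k+1} ≤ range N^k`). -/
theorem finrank_range_pow_succ_inf_ker_le (N : V →ₗ[K] V) (k : ℕ) :
    finrank K ↥(LinearMap.range (N ^ (k + 1)) ⊓ LinearMap.ker N) ≤ finrank K ↥(LinearMap.range (N ^ k) ⊓ LinearMap.ker N) :=
  Submodule.finrank_mono (inf_le_inf_right _ (by rw [pow_succ, Module.End.mul_eq_comp]; exact LinearMap.range_comp_le_range _ _))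

/-- telescoping: `rank N^k + Σ_{j<k} dim (range N^j ⊓ ker N) = dim V`. -/
theorem finrank_range_pow_add_sum (N : V →ₗ[K] V) (k : ℕ) :
    finrank K ↥(LinearMap.range (N ^ k)) + ∑ j ∈ Finset.range k, finrank K ↥(LinearMap.range (N ^ j) ⊓ LinearMap.ker N) = finrank K V := by
  induction k with
  | zero => rw [Finset.range_zero, Finset.sum_empty, add_zero, pow_zero, Module.End.one_eq_id, LinearMap.range_id, finrank_top]
  | succ k ih =>
    rw [Finset.sum_range_succ, ← ih, finrank_range_pow_eq_succ_add K N k]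
    omega

/-- **`dim ker N^k = Σ_{j<k} dim (range N^j ⊓ ker N)`** (the `j`-th drop counts the Jordan blocks of size `> j` when `N` is nilpotent). -/
theorem finrank_ker_pow_eq_sum (N : V →ₗ[K] V) (k : ℕ) :
    finrank K ↥(LinearMap.ker (N ^ k)) = ∑ j ∈ Finset.range k, finrank K ↥(LinearMap.range (N ^ j) ⊓ LinearMap.ker N) := by
  have h1 := LinearMap.finrank_range_add_finrank_ker (N ^ k)
  have h2 := finrank_range_pow_add_sum K N k
  omega

omit [Field K] in
/-- ARITHMETIC: a non-increasing sequence `b` with `q ≤ b_j` (`j < p`), `b_j ≤ q + 1` and `Σ_{j<p} b_j = pq + s` has `Σ_{j<k} b_j = kq + min(k, s)` for every `k ≤ p`. -/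
theorem sum_range_eq_of_antitone_of_bounds {b : ℕ → ℕ} {p q s : ℕ} (hanti : ∀ j, b (j + 1) ≤ b j) (hlo : ∀ j, j < p → q ≤ b j)
    (hhi : ∀ j, b j ≤ q + 1) (hsum : ∑ j ∈ Finset.range p, b j = p * q + s) {k : ℕ} (hk : k ≤ p) :
    ∑ j ∈ Finset.range k, b j = k * q + min k s := by
  have hmono : Antitone b := antitone_nat_of_succ_le hanti
  have hsplit := Finset.sum_range_add_sum_Ico b hk
  have htq : (p - k) * q + k * q = p * q := by rw [← add_mul, Nat.sub_add_cancel hk]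
  -- the head is at most `k(q+1)` and at least `kq`; the tail is at least `(p-k)q`
  have hhead_hi : ∑ j ∈ Finset.range k, b j ≤ k * q + k := by
    have h := Finset.sum_le_card_nsmul (Finset.range k) b (q + 1) fun j _ => hhi j
    rw [Finset.card_range, smul_eq_mul, mul_add_one] at h
    exact h
  have htail_lo : (p - k) * q ≤ ∑ j ∈ Finset.Ico k p, b j := by
    have h := Finset.card_nsmul_le_sum (Finset.Ico k p) b q fun j hj => hlo j (Finset.mem_Ico.mp hj).2
    rwa [Nat.card_Ico, smul_eq_mul] at h
  rcases Nat.eq_zero_or_pos k with hk0 | hk0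
  · subst hk0; simp
  rcases Nat.lt_or_ge (b (k - 1)) (q + 1) with hlow | hhigh
  · -- `b_{k-1} ≤ q`: every later drop is `≤ q`, so the tail is exactly `(p-k)q` and the head is `kq + s`
    have htail_hi : ∑ j ∈ Finset.Ico k p, b j ≤ (p - k) * q := by
      have h := Finset.sum_le_card_nsmul (Finset.Ico k p) b q fun j hj => by
        have := hmono (show k - 1 ≤ j from by have := (Finset.mem_Ico.mp hj).1; omega)
        omega
      rwa [Nat.card_Ico, smul_eq_mul] at h
    have hmin : min k s ≤ s := min_le_right k s
    have hmin' : min k s ≤ k := min_le_left k s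
    omega
  · -- `b_{k-1} ≥ q + 1`: every earlier drop is `q + 1`, so the head is `k(q+1)`
    have hhead_lo : k * q + k ≤ ∑ j ∈ Finset.range k, b j := by
      have h := Finset.card_nsmul_le_sum (Finset.range k) b (q + 1) fun j hj => by
        have := hmono (show j ≤ k - 1 from by have := Finset.mem_range.mp hj; omega)
        omega
      rw [Finset.card_range, smul_eq_mul, mul_add_one] at h
      exact h
    have hmin : min k s ≤ s := min_le_right k s
    have hmin' : min k s ≤ k := min_le_left k s
    have : min k s = k ∨ min k s = s := min_choice k s
    omega

/-- **JORDAN TYPE `(p, …, p, s)` FROM THREE NUMBERS: if `N^p = 0`, `dim V = pq + s`, `dim ker N = q + 1` and `rank N^{p−1} ≥ q`, then `dim ker N^k = kq + min(k, s)` for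
every `k ≤ p`** (the drops are squeezed between `q` and `q + 1` and sum to `pq + s`). -/
theorem finrank_ker_pow_eq_of_nilpotent {N : V →ₗ[K] V} {p q s : ℕ} (hp : 1 ≤ p) (hNp : N ^ p = 0) (hdim : finrank K V = p * q + s)
    (hker : finrank K ↥(LinearMap.ker N) = q + 1) (hrank : q ≤ finrank K ↥(LinearMap.range (N ^ (p - 1)))) {k : ℕ} (hk : k ≤ p) :
    finrank K ↥(LinearMap.ker (N ^ k)) = k * q + min k s := by
  rw [finrank_ker_pow_eq_sum]
  have hlast : finrank K ↥(LinearMap.range (N ^ (p - 1)) ⊓ LinearMap.ker N) = finrank K ↥(LinearMap.range (N ^ (p - 1))) := by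
    rw [inf_eq_left.mpr]
    rw [LinearMap.range_le_ker_iff, ← Module.End.mul_eq_comp, ← pow_succ', Nat.sub_add_cancel hp, hNp]
  refine sum_range_eq_of_antitone_of_bounds (finrank_range_pow_succ_inf_ker_le K N) (fun j hj => ?_)
    (fun j => (Submodule.finrank_mono inf_le_right).trans hker.le) ?_ hk
  · have hmono : Antitone fun j => finrank K ↥(LinearMap.range (N ^ j) ⊓ LinearMap.ker N) := antitone_nat_of_succ_le (finrank_range_pow_succ_inf_ker_le K N)
    have h := hmono (show j ≤ p - 1 by omega)
    simp only at h
    rw [hlast] at h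
    exact hrank.trans h
  · rw [← finrank_ker_pow_eq_sum, hNp, LinearMap.ker_zero, finrank_top, hdim]

end RankDrops

/-! ## §269. The leading term of `(SbC(shear λ) − 1)^k E_i` -/

/-- STRICT LOWER TRIANGULARITY: if the spike coordinates of `f` vanish below `i₀`, those of `(SbC(shear λ) − 1) f` vanish at every index `≤ i₀`. -/
theorem repr_SbC_shear_sub_one_eq_zero_of_le (lam : K) (f : spikeSpan K n) {i₀ : ℕ} (hvan : ∀ i : Fin (n + 1), (i : ℕ) < i₀ → (spikeBasis K n).repr f i = 0)
    (a : Fin (n + 1)) (ha : (a : ℕ) ≤ i₀) : (spikeBasis K n).repr ((SbC K 1 lam 0 1 - 1) f) a = 0 := by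
  rw [repr_SbC_shear_sub_one]
  refine Finset.sum_eq_zero fun i _ => ?_
  rcases Nat.lt_or_ge (i : ℕ) i₀ with hi | hi
  · rw [hvan i hi, mul_zero]
  · rw [Matrix.sub_apply, sbMat_shear_apply, Matrix.one_apply]
    by_cases hia : a = i
    · subst hia
      rw [if_pos le_rfl, if_pos rfl, Nat.choose_self, Nat.sub_self, pow_zero, Nat.cast_one, mul_one, sub_self, zero_mul]
    · rw [if_neg (fun h => hia (Fin.ext (by omega))), if_neg hia, sub_zero, zero_mul]

/-- **THE LEADING TERM OF `(SbC(shear λ) − 1)^k E_i`: its spike coordinates VANISH below `i + k`, and its `E_{i+k}`-coordinate is `(i+1)(i+2)⋯(i+k)·λ^k`**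
(`= (i+1).ascFactorial k · λ^k`; the Pascal matrix minus one has first sub-diagonal `(i+1)λ`, J4's pivot iterated). -/
theorem repr_SbC_shear_sub_one_pow_spikeBasis (lam : K) (i : Fin (n + 1)) (k : ℕ) :
    (∀ a : Fin (n + 1), (a : ℕ) < (i : ℕ) + k → (spikeBasis K n).repr (((SbC K 1 lam 0 1 - 1) ^ k) (spikeBasis K n i)) a = 0) ∧
    (∀ a : Fin (n + 1), (a : ℕ) = (i : ℕ) + k →
      (spikeBasis K n).repr (((SbC K 1 lam 0 1 - 1) ^ k) (spikeBasis K n i)) a = ((((i : ℕ) + 1).ascFactorial k : ℕ) : K) * lam ^ k) := by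
  induction k with
  | zero =>
    refine ⟨fun a ha => ?_, fun a ha => ?_⟩
    · rw [pow_zero, Module.End.one_apply, Basis.repr_self, Finsupp.single_apply, if_neg]
      intro e; rw [e] at ha; omega
    · rw [pow_zero, Module.End.one_apply, Basis.repr_self, Nat.ascFactorial_zero, Nat.cast_one, pow_zero, mul_one, Finsupp.single_apply,
        if_pos (Fin.ext (by omega))]
  | succ k ih =>
    obtain ⟨ihv, ihp⟩ := ih
    have hstep : ((SbC K 1 lam 0 1 - 1) ^ (k + 1)) (spikeBasis K n i) = (SbC K 1 lam 0 1 - 1) (((SbC K 1 lam 0 1 - 1) ^ k) (spikeBasis K n i)) := by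
      rw [pow_succ', Module.End.mul_apply]
    refine ⟨fun a ha => ?_, fun a ha => ?_⟩
    · rw [hstep]
      exact repr_SbC_shear_sub_one_eq_zero_of_le K lam _ (i₀ := (i : ℕ) + k) ihv a (by omega)
    · rw [hstep]
      have hlt : ((⟨(i : ℕ) + k, by omega⟩ : Fin (n + 1)) : ℕ) < n := by simp only; omega
      have key := repr_SbC_shear_sub_one_succ K lam (((SbC K 1 lam 0 1 - 1) ^ k) (spikeBasis K n i)) (i₀ := ⟨(i : ℕ) + k, by omega⟩) hlt
        (fun j hj => ihv j hj)
      have ea : a = ⟨(i : ℕ) + k + 1, by omega⟩ := Fin.ext (by simp only; omega)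
      rw [ea, key, ihp ⟨(i : ℕ) + k, by omega⟩ rfl, Nat.ascFactorial_succ, Nat.cast_mul, pow_succ]
      push_cast
      ring

/-- in particular **`(SbC(shear λ) − 1)^k E_i = 0` once `i + k > n`** (every field, every `λ`). -/
theorem SbC_shear_sub_one_pow_spikeBasis_eq_zero (lam : K) {i : Fin (n + 1)} {k : ℕ} (h : n < (i : ℕ) + k) :
    ((SbC K 1 lam 0 1 - 1) ^ k) (spikeBasis K n i) = 0 := by
  rw [← (spikeBasis K n).repr.map_eq_zero_iff]
  ext a
  rw [Finsupp.zero_apply]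
  exact (repr_SbC_shear_sub_one_pow_spikeBasis K lam i k).1 a (by have := a.2; omega)

/-- TRIANGULAR FAMILIES ARE INDEPENDENT: vectors `v i` of the class space (`i` in a set of spikes) whose spike coordinates vanish below `i + k` and do not vanish AT `i + k`
are linearly independent. -/
theorem linearIndependent_of_repr_pivot {I : Fin (n + 1) → Prop} (v : {i // I i} → spikeSpan K n) (k : ℕ)
    (hvan : ∀ (i : {i // I i}) (a : Fin (n + 1)), (a : ℕ) < ((i : Fin (n + 1)) : ℕ) + k → (spikeBasis K n).repr (v i) a = 0)
    (hpiv : ∀ i : {i // I i}, ∃ a : Fin (n + 1), (a : ℕ) = ((i : Fin (n + 1)) : ℕ) + k ∧ (spikeBasis K n).repr (v i) a ≠ 0) :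
    LinearIndependent K v := by
  classical
  rw [linearIndependent_iff']
  intro s g hsum
  by_contra hne
  push Not at hne
  obtain ⟨i₁, hi₁, hgi₁⟩ := hne
  obtain ⟨i₀, hi₀s, hmin⟩ := (s.filter fun i => g i ≠ 0).exists_min_image (fun i => ((i : Fin (n + 1)) : ℕ)) ⟨i₁, Finset.mem_filter.mpr ⟨hi₁, hgi₁⟩⟩
  obtain ⟨hi₀, hg₀⟩ := Finset.mem_filter.mp hi₀s
  obtain ⟨a, ha, hpa⟩ := hpiv i₀
  have h := congrArg (fun f : spikeSpan K n => (spikeBasis K n).repr f a) hsum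
  simp only [map_sum, map_smul, map_zero, Finsupp.finsetSum_apply, Finsupp.smul_apply, smul_eq_mul, Finsupp.zero_apply] at h
  rw [Finset.sum_eq_single i₀ (fun i hi hne => ?_) (fun h' => absurd hi₀ h')] at h
  · exact mul_ne_zero hg₀ hpa h
  · by_cases hgi : g i = 0
    · rw [hgi, zero_mul]
    · have hle := hmin i (Finset.mem_filter.mpr ⟨hi, hgi⟩)
      have hne' : ((i : Fin (n + 1)) : ℕ) ≠ ((i₀ : Fin (n + 1)) : ℕ) := fun e => hne (Subtype.ext (Fin.ext e))
      rw [hvan i a (by omega), mul_zero]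

open Classical in
/-- **the images `(SbC(shear λ) − 1)^k E_i`, over the spikes `i` with `i + k ≤ n` and `(i+1)(i+2)⋯(i+k) ≠ 0` in `K`, are linearly independent** (`λ ≠ 0`; distinct leading spikes). -/
theorem linearIndependent_SbC_shear_sub_one_pow_spikeBasis {lam : K} (hlam : lam ≠ 0) (k : ℕ) :
    LinearIndependent K fun i : {i : Fin (n + 1) // (i : ℕ) + k ≤ n ∧ ((((i : ℕ) + 1).ascFactorial k : ℕ) : K) ≠ 0} =>
      ((SbC K 1 lam 0 1 - 1) ^ k) (spikeBasis K n i) := by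
  refine linearIndependent_of_repr_pivot K (I := fun i : Fin (n + 1) => (i : ℕ) + k ≤ n ∧ ((((i : ℕ) + 1).ascFactorial k : ℕ) : K) ≠ 0) _ k
    (fun i a ha => (repr_SbC_shear_sub_one_pow_spikeBasis K lam (i : Fin (n + 1)) k).1 a ha) fun i => ?_
  refine ⟨⟨(i : ℕ) + k, by have := i.property.1; omega⟩, rfl, ?_⟩
  have h2 := (repr_SbC_shear_sub_one_pow_spikeBasis K lam (i : Fin (n + 1)) k).2 ⟨(i : ℕ) + k, by have := i.property.1; omega⟩ rfl
  rw [h2]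
  exact mul_ne_zero i.property.2 (pow_ne_zero _ hlam)

open Classical in
/-- **`rank (SbC(shear λ) − 1)^k ≥ #{i : i + k ≤ n, (i+1)(i+2)⋯(i+k) ≠ 0 in K}`** (every field, `λ ≠ 0`). -/
theorem card_le_finrank_range_SbC_shear_sub_one_pow {lam : K} (hlam : lam ≠ 0) (k : ℕ) :
    Fintype.card {i : Fin (n + 1) // (i : ℕ) + k ≤ n ∧ ((((i : ℕ) + 1).ascFactorial k : ℕ) : K) ≠ 0} ≤
      finrank K ↥(LinearMap.range ((SbC K 1 lam 0 1 (n := n) - 1) ^ k)) := by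
  let v : {i : Fin (n + 1) // (i : ℕ) + k ≤ n ∧ ((((i : ℕ) + 1).ascFactorial k : ℕ) : K) ≠ 0} → ↥(LinearMap.range ((SbC K 1 lam 0 1 (n := n) - 1) ^ k)) :=
    fun i => ⟨((SbC K 1 lam 0 1 - 1) ^ k) (spikeBasis K n i), LinearMap.mem_range_self _ _⟩
  have hv : LinearIndependent K v :=
    LinearIndependent.of_comp (LinearMap.range ((SbC K 1 lam 0 1 (n := n) - 1) ^ k)).subtype (linearIndependent_SbC_shear_sub_one_pow_spikeBasis K hlam k)
  exact hv.fintype_card_le_finrank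

/-! ## §270. Characteristic `p`: the partition `(p, …, p, n % p + 1)` -/

omit [Field K] in
/-- in characteristic `p`: `(mp+1)(mp+2)⋯(mp+j) ≠ 0` in `K` for `j < p` (no factor is a multiple of `p`). -/
theorem ascFactorial_mul_prime_succ_cast_ne_zero (K : Type*) [CommRing K] [IsDomain K] (p : ℕ) [Fact p.Prime] [CharP K p] (m : ℕ) {j : ℕ} (hj : j < p) :
    (((m * p + 1).ascFactorial j : ℕ) : K) ≠ 0 := by
  induction j with
  | zero => rw [Nat.ascFactorial_zero, Nat.cast_one]; exact one_ne_zero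
  | succ j ih =>
    rw [Nat.ascFactorial_succ, Nat.cast_mul]
    refine mul_ne_zero ?_ (ih (by omega))
    rw [Ne, CharP.cast_eq_zero_iff K p, show m * p + 1 + j = j + 1 + p * m by ring, Nat.dvd_add_left (Dvd.intro m rfl)]
    exact Nat.not_dvd_of_pos_of_lt (Nat.succ_pos j) (by omega)

open Classical in
/-- **`rank (SbC(shear λ) − 1)^{p−1} ≥ (n+1)/p` IN CHARACTERISTIC `p`** (`λ ≠ 0`): the spikes `E_{mp}` with `(m+1)p ≤ n + 1` have independent images with leading terms
`(p−1)!·λ^{p−1}·E_{mp+p−1}` (at least `(n+1)/p` Jordan blocks of size `p`). -/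
theorem div_le_finrank_range_SbC_shear_sub_one_pow_pred_char {lam : K} (hlam : lam ≠ 0) (p : ℕ) [Fact p.Prime] [CharP K p] :
    (n + 1) / p ≤ finrank K ↥(LinearMap.range ((SbC K 1 lam 0 1 (n := n) - 1) ^ (p - 1))) := by
  have hp : p.Prime := Fact.out
  refine le_trans ?_ (card_le_finrank_range_SbC_shear_sub_one_pow K hlam (p - 1))
  let ι : Fin ((n + 1) / p) → {i : Fin (n + 1) // (i : ℕ) + (p - 1) ≤ n ∧ ((((i : ℕ) + 1).ascFactorial (p - 1) : ℕ) : K) ≠ 0} := fun m =>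
    ⟨⟨(m : ℕ) * p, by
        have h := (Nat.le_div_iff_mul_le hp.pos).mp (Nat.add_one_le_iff.mpr m.2)
        have h2 := hp.two_le
        rw [add_one_mul] at h; omega⟩,
      ⟨by
        have h := (Nat.le_div_iff_mul_le hp.pos).mp (Nat.add_one_le_iff.mpr m.2)
        have h2 := hp.two_le
        simp only
        rw [add_one_mul] at h; omega,
       ascFactorial_mul_prime_succ_cast_ne_zero K p m (Nat.sub_lt hp.pos one_pos)⟩⟩
  have hι : Function.Injective ι := fun m m' h => by
    have e := congrArg (fun x => ((x.1 : Fin (n + 1)) : ℕ)) h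
    simp only [ι] at e
    exact Fin.ext (Nat.eq_of_mul_eq_mul_right hp.pos e)
  have := Fintype.card_le_of_injective ι hι
  rwa [Fintype.card_fin] at this

/-- **THE JORDAN TYPE OF THE SHEAR ON TH-7's CLASSES IN CHARACTERISTIC `p` IS `(p, …, p, n % p + 1)`:
`dim ker (SbC(shear λ) − 1)^k = (n / p) · min(k, p) + min(k, n % p + 1)` for every `k`** (`λ ≠ 0`; `⌊n/p⌋` blocks of size `p` and one block of size `n % p + 1`;
J4 is `k = 1`, J3 is the nilpotency index `min(p, n+1)`). -/
theorem finrank_ker_SbC_shear_sub_one_pow_char {lam : K} (hlam : lam ≠ 0) (p : ℕ) [Fact p.Prime] [CharP K p] (k : ℕ) :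
    finrank K ↥(LinearMap.ker ((SbC K 1 lam 0 1 (n := n) - 1) ^ k)) = n / p * min k p + min k (n % p + 1) := by
  have hp : p.Prime := Fact.out
  have hdm := Nat.div_add_mod n p
  rcases le_or_gt k p with hk | hk
  · rw [min_eq_left hk, mul_comm]
    refine finrank_ker_pow_eq_of_nilpotent K hp.one_le (SbC_shear_sub_one_pow_char K lam p) ?_ (finrank_ker_SbC_shear_sub_one_char K hlam p) ?_ hk
    · rw [finrank_eq_card_basis (spikeBasis K n), Fintype.card_fin]; omega
    · exact (Nat.div_le_div_right (Nat.le_succ n)).trans (div_le_finrank_range_SbC_shear_sub_one_pow_pred_char K hlam p)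
  · rw [min_eq_right hk.le, min_eq_right (by have := Nat.mod_lt n hp.pos; omega), pow_eq_zero_of_le hk.le (SbC_shear_sub_one_pow_char K lam p),
      LinearMap.ker_zero, finrank_top, finrank_eq_card_basis (spikeBasis K n), Fintype.card_fin, mul_comm]
    omega

/-- `k ≤ p`: **`dim ker (SbC(shear λ) − 1)^k = k·⌊n/p⌋ + min(k, n % p + 1)`**. -/
theorem finrank_ker_SbC_shear_sub_one_pow_char_of_le {lam : K} (hlam : lam ≠ 0) (p : ℕ) [Fact p.Prime] [CharP K p] {k : ℕ} (hk : k ≤ p) :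
    finrank K ↥(LinearMap.ker ((SbC K 1 lam 0 1 (n := n) - 1) ^ k)) = k * (n / p) + min k (n % p + 1) := by
  rw [finrank_ker_SbC_shear_sub_one_pow_char K hlam p k, min_eq_left hk, mul_comm]

/-- **THE RANK: `rank (SbC(shear λ) − 1)^k + (⌊n/p⌋·min(k,p) + min(k, n % p + 1)) = n + 1`** in characteristic `p` (`λ ≠ 0`). -/
theorem finrank_range_SbC_shear_sub_one_pow_char {lam : K} (hlam : lam ≠ 0) (p : ℕ) [Fact p.Prime] [CharP K p] (k : ℕ) :
    finrank K ↥(LinearMap.range ((SbC K 1 lam 0 1 (n := n) - 1) ^ k)) + (n / p * min k p + min k (n % p + 1)) = n + 1 := by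
  rw [← finrank_ker_SbC_shear_sub_one_pow_char K hlam p k, LinearMap.finrank_range_add_finrank_ker, finrank_eq_card_basis (spikeBasis K n), Fintype.card_fin]

/-- **THE NUMBER OF JORDAN BLOCKS OF SIZE `> k` IS `⌊n/p⌋ + [k ≤ n % p]`** (`k < p`): `dim (range (SbC(shear λ) − 1)^k ⊓ ker (SbC(shear λ) − 1)) = n / p + (if k ≤ n % p
then 1 else 0)` in characteristic `p` (`λ ≠ 0`; `k = 0` is J4's count `n / p + 1` of all blocks). -/
theorem finrank_range_pow_inf_ker_SbC_shear_char {lam : K} (hlam : lam ≠ 0) (p : ℕ) [Fact p.Prime] [CharP K p] {k : ℕ} (hk : k < p) :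
    finrank K ↥(LinearMap.range ((SbC K 1 lam 0 1 (n := n) - 1) ^ k) ⊓ LinearMap.ker (SbC K 1 lam 0 1 (n := n) - 1)) =
      n / p + (if k ≤ n % p then 1 else 0) := by
  have h0 := finrank_range_pow_eq_succ_add K (SbC K 1 lam 0 1 (n := n) - 1) k
  have h1 := finrank_range_SbC_shear_sub_one_pow_char K hlam p k (n := n)
  have h2 := finrank_range_SbC_shear_sub_one_pow_char K hlam p (k + 1) (n := n)
  rw [min_eq_left hk.le] at h1
  rw [min_eq_left (Nat.succ_le_of_lt hk), Nat.mul_succ] at h2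
  by_cases hks : k ≤ n % p
  · rw [if_pos hks, min_eq_left (by omega : k ≤ n % p + 1)] at *
    rw [min_eq_left (by omega : k + 1 ≤ n % p + 1)] at h2
    omega
  · rw [if_neg hks, min_eq_right (by omega : n % p + 1 ≤ k)] at *
    rw [min_eq_right (by omega : n % p + 1 ≤ k + 1)] at h2
    omega

/-- **`rank (SbC(shear λ) − 1)^{p−1} = (n+1)/p` IN CHARACTERISTIC `p`** (`λ ≠ 0`): the number of Jordan blocks of size exactly `p`. -/
theorem finrank_range_SbC_shear_sub_one_pow_pred_char {lam : K} (hlam : lam ≠ 0) (p : ℕ) [Fact p.Prime] [CharP K p] :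
    finrank K ↥(LinearMap.range ((SbC K 1 lam 0 1 (n := n) - 1) ^ (p - 1))) = (n + 1) / p := by
  have hp : p.Prime := Fact.out
  have h := finrank_range_SbC_shear_sub_one_pow_char K hlam p (p - 1) (n := n)
  have hdm := Nat.div_add_mod' n p
  have hlt := Nat.mod_lt n hp.pos
  rw [min_eq_left (Nat.sub_le p 1), Nat.mul_sub_one] at h
  have hqp : n / p ≤ n / p * p := Nat.le_mul_of_pos_right _ hp.pos
  by_cases hs : n % p + 1 = p
  · -- `p ∣ n + 1`: `(n+1)/p = n/p + 1`
    have e : n + 1 = p * (n / p + 1) := by rw [mul_add_one, mul_comm]; omega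
    rw [e, Nat.mul_div_cancel_left _ hp.pos]
    rw [min_eq_left (by omega : p - 1 ≤ n % p + 1)] at h
    omega
  · have e : (n + 1) / p = n / p := Nat.div_eq_of_lt_le (by omega) (by rw [add_one_mul]; omega)
    rw [e]
    rw [min_eq_right (by omega : n % p + 1 ≤ p - 1)] at h
    omega

end Summit.Ventures.HSemireg.Wedge.HankelFrameChange
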